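import Mathlib

/-!
# (B3)/(α′) SPLIT — monad cohomology with degeneracy vs. the sheaf door's typing; the everywhere q-budget
# for Hall-tight three-term designs on `X = (E×E)⁴` — kernel + spec (hsemireg-monad-4 g9)

hsemireg-monad-4 g9 (planner-hsemireg-monad-4-g9-0), 2026-08-30.  D-0145 token:
`line stmt-HodgeConjecture-18881 Cruxes/BlochSeedDiscOne/Lines/birth.lean 814a6a70c14e831a stub_rung_pad4_seedAt`.
Companion memo: `Cruxes/BlochSeedDiscOne/B3-ALPHA-SPLIT-T40-monad4-g9.md`; table `B3ALPHA-qbudget-table.{tsv,json}`.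

CENSUS-NEUTRAL.  Nothing in this file is a rung or a step toward HC / HC_CM / HC_AV / №4 / 26512 / 18881 / H2.
A letter design ≠ a monad ≠ a sheaf ≠ a SEED.  This file is evidence + a typed spec: Mathlib-only, no `sorry`,
no new axioms, no `instance`, no `notation`, no banned options.  The pen theorems of the memo (LEMMA α′-split,
THEOREM Q∞, LEMMA M) are NOT formalised here; what is kernel-checked is (i) the pointwise linear algebra of a
monad datum, (ii) the additive bookkeeping behind the split `ch(E) = design + ch(coker q)`, (iii) the letter-level
budget rows of the memo's TABLE (`decide`).

* §1 KERNEL (pointwise).  For linear maps `i : A → N`, `q : N → C` over a field with `q ∘ i = 0`: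
  `finrank (ker q ⧸ im i) + rank i + rank q = dim N` (`finrank_homology_add`); at a point where `q` is onto and
  `i` is injective the homology has the DESIGN RANK `dim N − dim A − dim C` (`finrank_homology_of_onto_of_inj`).
  This is the fibrewise content of (α′): `E = ker q ∕ im i` is locally free of the design rank WITH THE DESIGN CLASS
  iff `q(x)` is onto and `i(x)` is injective at EVERY point `x` (memo LEMMA α′-split (c); Nakayama on
  `0 → 𝒜 → K → E → 0`, `K = ker q`; without the class clause a divisor-supported `coker q` can leave `E` locally free).
* §2 KERNEL (bookkeeping).  In any additive group of classes: from `0 → K → N → C → Q → 0` and `0 → A → K → E → 0`,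
  `ch E = (ch N − ch A − ch C) + ch Q` (`ch_split`), so `ch E = design ↔ ch Q = 0` (`ch_eq_design_iff`), and
  degree-wise: if `ch_p Q = 0` for `p < d` then `ch_p E = design_p` for `p < d` (`window_agreement`) — the WINDOW
  form used by the memo: a monad whose `q` degenerates only in codimension `≥ d` realises the design's class in
  all degrees `< d` [Fulton, Intersection Theory, Ex. 18.3.11 ∕ 15.3.6: `ch(Q)` starts in degree `codim supp Q` with
  the support cycle], and in NO degree `≥ d` pattern can it realise it in degree `d` when `Q ≠ 0` (effective cycle).
* §3 SPEC (letters; Bool-valued, rows `decide`d).  B2RIGID Theorem S + T40PAIR §8(a) (pen ×2 of record):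
  for a Hall-tight design of the (H1) alphabet with `m = 4` copies of N35, `e` hub lines in `N`, N18-multiplicity
  `m₁₈` and hub rank `c`,  `rank q(x) ≤ dim S + e + m₁₈ · #{N18 positions alive at x}`, `dim S ≤ 12`, and on the
  stratum `Σ_D` of `j` dead positions (`≤ 2` per factor, `j ≤ 8`; non-empty of pure codimension `j`) at most
  `16 − j` N18 positions are alive.  `SBudget.ontoOK B j` := `c ≤ dim S + e + m₁₈ (16 − j)` is therefore NECESSARY
  for `q` to be onto at the points of `Σ_D`, `|D| = j`.  Rows: T40 = (40,184): onto possible through `j = 4`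
  (the (B2) screen, tight) and IMPOSSIBLE from `j = 5` on (`23 < 24`): `D(q) ⊇ Σ_D` for all 3 264 five-sets `D`;
  H40 = (40,186)a likewise (`24 < 25`); the under-bound types (48,176), (32,194) pass the count at every `j ≤ 8`
  (silent).  `deadSets j` = the number of admissible `j`-sets = `[x^j] (1 + 4x + 6x²)⁴` (rows `decide`d:
  1, 16, 120, 544, 1624, 3264, 4320, 3456, 1296; check-flow-1 BATCH 35 digits for `j ≤ 4`).
-/

namespace Summit.HodgeConjecture.HodgeConjecture.Cruxes.BlochSeedDiscOne.B3AlphaSplit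

section Kernel

variable {k : Type*} [Field k]
variable {A N C : Type*} [AddCommGroup A] [Module k A] [AddCommGroup N] [Module k N]
  [AddCommGroup C] [Module k C] [FiniteDimensional k N]

omit [FiniteDimensional k N] in
/-- In a monad datum `q ∘ i = 0` the image of `i` lies in the kernel of `q`. -/
theorem range_le_ker (i : A →ₗ[k] N) (q : N →ₗ[k] C) (h : q ∘ₗ i = 0) :
    LinearMap.range i ≤ LinearMap.ker q :=
  LinearMap.range_le_ker_iff.mpr h

/-- **Pointwise homology count.**  `dim (ker q ⧸ im i) + rank i + rank q = dim N` for `q ∘ i = 0`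
(the quotient is taken inside `ker q`, where `im i` lands by `range_le_ker`). -/
theorem finrank_homology_add (i : A →ₗ[k] N) (q : N →ₗ[k] C) (h : q ∘ₗ i = 0) :
    Module.finrank k (LinearMap.ker q ⧸ (LinearMap.range i).comap (LinearMap.ker q).subtype)
      + Module.finrank k (LinearMap.range i) + Module.finrank k (LinearMap.range q)
      = Module.finrank k N := by
  have hle : LinearMap.range i ≤ LinearMap.ker q := range_le_ker i q h
  have h1 := Submodule.finrank_quotient_add_finrank
    ((LinearMap.range i).comap (LinearMap.ker q).subtype)
  have h2 : Module.finrank k ((LinearMap.range i).comap (LinearMap.ker q).subtype)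
      = Module.finrank k (LinearMap.range i) :=
    (Submodule.comapSubtypeEquivOfLe hle).finrank_eq
  have h3 := LinearMap.finrank_range_add_finrank_ker q
  omega

/-- **(α′) pointwise**: where `q(x)` is onto and `i(x)` is injective, the homology `ker q ⧸ im i` has the
DESIGN RANK: `dim H + dim A + dim C = dim N`. -/
theorem finrank_homology_of_onto_of_inj [FiniteDimensional k C] (i : A →ₗ[k] N) (q : N →ₗ[k] C)
    (h : q ∘ₗ i = 0) (hq : Function.Surjective q) (hi : Function.Injective i) :
    Module.finrank k (LinearMap.ker q ⧸ (LinearMap.range i).comap (LinearMap.ker q).subtype)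
      + Module.finrank k A + Module.finrank k C = Module.finrank k N := by
  have h0 := finrank_homology_add i q h
  have hA : Module.finrank k (LinearMap.range i) = Module.finrank k A :=
    LinearMap.finrank_range_of_inj hi
  have hC : Module.finrank k (LinearMap.range q) = Module.finrank k C := by
    rw [LinearMap.range_eq_top.mpr hq, finrank_top]
  omega

/-- **Rank drop raises homology**: if `rank q(x) + s = dim C` and `rank i(x) + t = dim A` (drops `s, t`), then
`dim H(x) = (dim N − dim A − dim C) + s + t` — the homology at a degenerate point EXCEEDS the design rank by the
total drop (so `E` cannot be locally free of the design rank there unless `s = t = 0`; memo LEMMA α′-split (c)). -/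
theorem finrank_homology_of_drops [FiniteDimensional k C] (i : A →ₗ[k] N) (q : N →ₗ[k] C)
    (h : q ∘ₗ i = 0) (s t : ℕ)
    (hq : Module.finrank k (LinearMap.range q) + s = Module.finrank k C)
    (hi : Module.finrank k (LinearMap.range i) + t = Module.finrank k A)
    (hr : Module.finrank k A + Module.finrank k C ≤ Module.finrank k N) :
    Module.finrank k (LinearMap.ker q ⧸ (LinearMap.range i).comap (LinearMap.ker q).subtype)
      = (Module.finrank k N - Module.finrank k A - Module.finrank k C) + s + t := by
  have h0 := finrank_homology_add i q h
  omega

end Kernel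

section Bookkeeping

variable {G : Type*} [AddCommGroup G]

/-- **(α′-split), additive form.**  From `ch K = ch N − ch C + ch Q` (`0 → K → N → C → Q → 0`) and
`ch E = ch K − ch A` (`0 → A → K → E → 0`): `ch E = (ch N − ch A − ch C) + ch Q`. -/
theorem ch_split (chN chA chC chQ chK chE : G) (hK : chK = chN - chC + chQ) (hE : chE = chK - chA) :
    chE = (chN - chA - chC) + chQ := by
  subst hE; subst hK; abel

/-- `ch E` is the design class `ch N − ch A − ch C` iff `ch Q = 0`. -/
theorem ch_eq_design_iff (chN chA chC chQ chK chE : G) (hK : chK = chN - chC + chQ)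
    (hE : chE = chK - chA) : chE = chN - chA - chC ↔ chQ = 0 := by
  rw [ch_split chN chA chC chQ chK chE hK hE]
  constructor
  · intro h'; simpa using h'
  · intro h'; simp [h']

/-- **Window agreement.**  Degree-wise version: if `ch_p Q = 0` for all `p < d` (e.g. `supp Q` of codimension
`≥ d`), then `ch_p E = design_p` for all `p < d`. -/
theorem window_agreement (chN chA chC chQ chK chE : ℕ → G) (d : ℕ)
    (hK : ∀ p, chK p = chN p - chC p + chQ p) (hE : ∀ p, chE p = chK p - chA p)
    (hQ : ∀ p < d, chQ p = 0) : ∀ p < d, chE p = chN p - chA p - chC p := by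
  intro p hp
  rw [ch_split (chN p) (chA p) (chC p) (chQ p) (chK p) (chE p) (hK p) (hE p), hQ p hp, add_zero]

/-- … and in the first degree where `ch_d Q ≠ 0` the class of `E` is NOT the design's. -/
theorem first_discrepancy (chN chA chC chQ chK chE : ℕ → G) (d : ℕ)
    (hK : ∀ p, chK p = chN p - chC p + chQ p) (hE : ∀ p, chE p = chK p - chA p)
    (hQ : chQ d ≠ 0) : chE d ≠ chN d - chA d - chC d := by
  rw [Ne, ch_eq_design_iff (chN d) (chA d) (chC d) (chQ d) (chK d) (chE d) (hK d) (hE d)]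
  exact hQ

end Bookkeeping

section Spec

/-- Letter data of a Hall-tight three-term design in the B2RIGID alphabet entering the q-budget:
`dimS` (≤ 12 for `m = 4`), `e` = hub lines in `N`, `m18` = N18 multiplicity, `c` = hub rank of `C`. -/
structure SBudget where
  dimS : ℕ
  e : ℕ
  m18 : ℕ
  c : ℕ

/-- the Theorem-S upper bound for `rank q(x)` at a point with `j` dead N18 positions -/
def SBudget.bound (B : SBudget) (j : ℕ) : ℕ := B.dimS + B.e + B.m18 * (16 - j)

/-- NECESSARY letter condition for `q` onto at the points of a stratum `Σ_D`, `|D| = j` -/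
def SBudget.ontoOK (B : SBudget) (j : ℕ) : Bool := decide (B.c ≤ B.bound j)

/-- (B2) screen for `q` (degeneracy in codimension ≥ 5 tolerated): onto on every codim-≤-4 stratum -/
def SBudget.b2OK (B : SBudget) : Bool := B.ontoOK 4

/-- (α′)-everywhere ∕ locally-free-door necessary count: onto at the codim-8 points `Σ_D`, `|D| = 8` -/
def SBudget.lfDoorOK (B : SBudget) : Bool := B.ontoOK 8

/-- the law in closed form for `m₁₈ = 1`: failure at `j ≤ 16` iff `dim S + e + 16 < c + j` -/
theorem SBudget.ontoOK_false_iff (B : SBudget) (h18 : B.m18 = 1) {j : ℕ} (hj : j ≤ 16) :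
    B.ontoOK j = false ↔ B.dimS + B.e + 16 < B.c + j := by
  simp only [SBudget.ontoOK, SBudget.bound, h18, one_mul, decide_eq_false_iff_not, not_le]
  omega

/-- monotonicity: deeper strata are harder -/
theorem SBudget.bound_antitone (B : SBudget) {j j' : ℕ} (h : j ≤ j') : B.bound j' ≤ B.bound j := by
  unfold SBudget.bound
  have : B.m18 * (16 - j') ≤ B.m18 * (16 - j) := Nat.mul_le_mul_left _ (by omega)
  omega

theorem SBudget.ontoOK_antitone (B : SBudget) {j j' : ℕ} (h : j ≤ j') (h' : B.ontoOK j' = true) :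
    B.ontoOK j = true := by
  simp only [SBudget.ontoOK, decide_eq_true_eq] at h' ⊢
  exact h'.trans (B.bound_antitone h)

/-- the designs of the memo's TABLE -/
def T40 : SBudget := ⟨12, 0, 1, 24⟩
def H40 : SBudget := ⟨12, 1, 1, 25⟩
def UB48 : SBudget := ⟨12, 0, 1, 16⟩
def UB32 : SBudget := ⟨12, 0, 1, 17⟩

example : (List.range 9).map T40.bound = [28, 27, 26, 25, 24, 23, 22, 21, 20] := by decide
example : (List.range 9).map T40.ontoOK
    = [true, true, true, true, true, false, false, false, false] := by decide
/-- T40: (B2) screen tight-PASS at codim 4, (α′)-everywhere FAIL from codim 5 on (`23 < 24`). -/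
theorem T40_row : T40.b2OK = true ∧ T40.ontoOK 5 = false ∧ T40.lfDoorOK = false := by decide
/-- H40 = (40,186)a (one hub line): same profile one unit up (`24 < 25` at codim 5). -/
theorem H40_row : H40.b2OK = true ∧ H40.ontoOK 5 = false ∧ H40.lfDoorOK = false := by decide
/-- under-bound types: the count is silent down to the codim-8 points (`16, 17 ≤ 20`). -/
theorem UB_rows : UB48.lfDoorOK = true ∧ UB32.lfDoorOK = true := by decide
/-- DESIGN RULE DR-Q∞ in this alphabet (`dim S ≤ 12`, `m₁₈ = 1`, no hub line): the locally-free door needs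
`c ≤ 20`. -/
example : (⟨12, 0, 1, 20⟩ : SBudget).lfDoorOK = true ∧ (⟨12, 0, 1, 21⟩ : SBudget).lfDoorOK = false := by
  decide

/-- number of admissible sets of `j` dead positions (4 factors × 4 chains, ≤ 2 per factor):
`[x^j] (1 + 4x + 6x²)⁴`. -/
def deadSets (j : ℕ) : ℕ :=
  ∑ d₀ ∈ Finset.range 3, ∑ d₁ ∈ Finset.range 3, ∑ d₂ ∈ Finset.range 3, ∑ d₃ ∈ Finset.range 3,
    if d₀ + d₁ + d₂ + d₃ = j then
      Nat.choose 4 d₀ * Nat.choose 4 d₁ * Nat.choose 4 d₂ * Nat.choose 4 d₃ else 0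

theorem deadSets_table :
    (List.range 9).map deadSets = [1, 16, 120, 544, 1624, 3264, 4320, 3456, 1296] := by decide

theorem deadSets_total : ((List.range 9).map deadSets).sum = 11 ^ 4 := by decide

/-- T40: the degeneracy locus of `q` contains all `deadSets 5 = 3264` five-set strata (each non-empty of pure
codimension 5), i.e. `codim D(q) = 5` exactly for every pair in the normal form — consistent with (B2), fatal for
the locally-free door. -/
example : deadSets 5 = 3264 ∧ T40.ontoOK 5 = false := by decide

end Spec

end Summit.HodgeConjecture.HodgeConjecture.Cruxes.BlochSeedDiscOne.B3AlphaSplit
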